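import Summits.KontsevichZagierPeriods.KontsevichZagierPeriods.Theorems.RootDecompWalshStrataHtypeChart

/-!
# Root decomposition (Walsh strata), part 48 — H-type fibre discriminants II: boundary sections of the chart domain

The boundary sections `[S, P(v, ζ(v))]` left by the chart engine `InBaker.of_Hhalf` (part 47) are sorted by
the frontier of the chart domain `hDom e g m U` (`frontier_hDom`) and the wall locus of `U`:

* `v = 0`, `m v² = 1`: null / the potential vanishes (`g_m(±1/√m) = 0`);
* `H(ζ(v)) = 0`, i.e. `ζ ≡ ±x_*`, `x_* = √(−g/e)`: the integrand `±(2γg/3)·x_*·g_m(v)` is an even rational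
  function of `v` times an algebraic constant — the landed `InBaker.sqrt_const_even` (48.2);
* the chart point `Φ(v, ζ(v))` lies on a listed LINE with `k₂ = 0`: `ζ ≡ −k₀/k₁ ∈ ℚ` and the integrand
  `γ·Hi(−k₀/k₁)·g_m(v)` is `ℚ`-rational (`InBaker.of_eqOn_aeval_div`);
* it lies on a listed line with `k₂ ≠ 0`, or on a conic wall `R_H = q_j²`: these are the two TYPED RESIDUAL
  families `R-HL`, `R-HC` of the node (one-variable Euler-type terminals along line / conic edges in the chart
  parametrisation; their `x`-reparametrisation is the landed `VertexChart.edge_pullback`), taken as hypotheses.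

* 48.1 Semialgebraic functions on the chart plane composed with the chart and with section graphs.
* 48.2 `InBaker.of_hzero_section`.
* (part 48b, `RootDecompWalshStrataHtypeSectionEngine`) the dispatcher `InBaker.of_Hsections` and the engine with
  typed residuals `InBaker.of_Hhalf'`.

References: [KontsevichZagier2001 §1.2 rules (1)–(3)], [BCR1998 §2.2].
-/

noncomputable section
/-- `(x, t)₀ = x₀` on `Fin 2`. [bookkeeping] -/
private theorem snoc₂_zero (x : Fin 1 → ℝ) (t : ℝ) : (Fin.snoc x t : Fin 2 → ℝ) 0 = x 0 := rfl

/-- `(x, t)₁ = t` on `Fin 2`. [bookkeeping] -/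
private theorem snoc₂_one (x : Fin 1 → ℝ) (t : ℝ) : (Fin.snoc x t : Fin 2 → ℝ) 1 = t := rfl

open Set MeasureTheory MvPolynomial Literature.NumberTheory.Transcendental
open Literature.ModelTheory.ExponentialFields (IsSemialgebraic isSemialgebraic_univ isSemialgebraic_empty)
open Summit.KontsevichZagierPeriods.RootDecompWalshStrata.ConicDescent.VertexChart

namespace Summit.KontsevichZagierPeriods.RootDecompWalshStrata.ConicDescent.BallCube

/-! #### 48.1 Semialgebraic functions on the chart plane -/

section salg

variable {e g m : ℚ}

/-- `p ↦ H(p 1) = e p₁² + g` is `ℚ`-semialgebraic. [BCR1998 §2.2] -/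
theorem isSemialgebraicFunOn_hH (e g : ℚ) :
    IsSemialgebraicFunOn ℚ (univ : Set (Fin 2 → ℝ)) fun p => (e : ℝ) * p 1 ^ 2 + g :=
  (isSemialgebraicFunOn_aeval isSemialgebraic_univ (C e * X 1 ^ 2 + C g : MvPolynomial (Fin 2) ℚ)).congr
    fun p _ => by
      simp only [map_add, map_mul, map_pow, MvPolynomial.aeval_C, MvPolynomial.aeval_X, eq_ratCast]

/-- `R_H` is `ℚ`-semialgebraic. [BCR1998 §2.2] -/
theorem isSemialgebraicFunOn_hrad (e g m : ℚ) :
    IsSemialgebraicFunOn ℚ (univ : Set (Fin 2 → ℝ)) (hrad e g m) :=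
  (isSemialgebraicFunOn_aeval isSemialgebraic_univ
    (C e * X 0 ^ 2 + C g - C m * X 1 ^ 2 : MvPolynomial (Fin 2) ℚ)).congr fun p _ => by
      simp only [map_add, map_sub, map_mul, map_pow, MvPolynomial.aeval_C, MvPolynomial.aeval_X,
        eq_ratCast, hrad]

/-- `p ↦ R_H(Φ(p))` is `ℚ`-semialgebraic. [BCR1998 Prop. 2.2.6] -/
theorem isSemialgebraicFunOn_hrad_vΦ (hm : 0 ≤ m) :
    IsSemialgebraicFunOn ℚ (univ : Set (Fin 2 → ℝ)) fun p => hrad e g m (vΦ m 0 (hP e g) p) :=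
  IsSemialgebraicFunOn.comp_isSemialgebraicMapOn_holds (k := ℚ) (isSemialgebraicFunOn_hrad e g m)
    (isSemialgebraicMapOn_vΦ (Y₀ := 0) (H := hP e g) hm isSemialgebraic_univ) (mapsTo_univ _ _)

/-- `p ↦ L(Φ(p))` is `ℚ`-semialgebraic for a wall `L`. [BCR1998 Prop. 2.2.6] -/
theorem Wall.isSemialgebraicFunOn_eval_vΦ (L : Wall) (hm : 0 ≤ m) :
    IsSemialgebraicFunOn ℚ (univ : Set (Fin 2 → ℝ)) fun p =>
      L.eval (vΦ m 0 (hP e g) p 0) (vΦ m 0 (hP e g) p 1) :=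
  IsSemialgebraicFunOn.comp_isSemialgebraicMapOn_holds (k := ℚ)
    (L.isSemialgebraicFunOn_eval isSemialgebraic_univ)
    (isSemialgebraicMapOn_vΦ (Y₀ := 0) (H := hP e g) hm isSemialgebraic_univ) (mapsTo_univ _ _)

/-- The chart point of a section graph: `Φ(v, ζ(v)) = (ζ(v), √H(ζ(v))·U_m(v))`. [bookkeeping] -/
theorem vΦ_snoc (b : Fin 1 → ℝ) (t : ℝ) :
    vΦ m 0 (hP e g) (Fin.snoc b t) 0 = t ∧
      vΦ m 0 (hP e g) (Fin.snoc b t) 1 = √((e : ℝ) * t ^ 2 + g) * gU m (b 0) := by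
  refine ⟨by rw [vΦ_zero, snoc₂_one], ?_⟩
  rw [vΦ_one, map_zero, zero_add, snoc₂_zero, snoc₂_one, vS, aeval_hP]

end salg

/-! #### 48.2 Sections on the lines `H = 0` -/

/-- Sections on the lines `H(x) = 0` (`x = ±x_*`, `x_* = √(−g/e)`): the integrand
`γ·Hi(±x_*)·g_m(v) = ±(2γg/3)·x_*·g_m(v)` is an EVEN rational function of `v` times the algebraic
constant `x_*` — the landed `InBaker.sqrt_const_even` (ANY domain). [this node] -/
theorem InBaker.of_hzero_section {e g m : ℚ} (he : 0 < e) (hm : 0 ≤ m) (γ s : ℚ) (hs : s = 1 ∨ s = -1)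
    (r : KZ.IntegralRep 1) {ζ : (Fin 1 → ℝ) → ℝ}
    (hH : ∀ b ∈ r.domain, (e : ℝ) * ζ b ^ 2 + g = 0 ∧ 0 ≤ (s : ℝ) * ζ b)
    (hr : EqOn r.integrand (fun b => hpot γ e g m (Fin.snoc b (ζ b))) r.domain) :
    InBaker (KZ.of r) := by
  have he' : (0 : ℝ) < e := by exact_mod_cast he
  by_cases hT0 : r.domain = ∅
  · exact InBaker.of_domain_eq_empty _ hT0
  obtain ⟨b₀, hb₀⟩ := nonempty_iff_ne_empty.2 hT0
  obtain ⟨q₀, hq₀⟩ : ∃ q₀ : ℝ, q₀ = ((-g / e : ℚ) : ℝ) := ⟨_, rfl⟩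
  have heq : (e : ℝ) * q₀ = -g := by
    rw [hq₀]
    push_cast
    field_simp
  have hsq : ∀ b ∈ r.domain, ζ b ^ 2 = q₀ := fun b hb => by
    have h := (hH b hb).1
    rw [hq₀]
    push_cast
    field_simp
    linarith
  have hs2 : (s : ℝ) ^ 2 = 1 := by
    rcases hs with rfl | rfl <;> norm_num
  obtain ⟨x, hx⟩ : ∃ x : ℝ, x = √q₀ := ⟨_, rfl⟩
  have hq0 : 0 ≤ q₀ := (hsq b₀ hb₀) ▸ sq_nonneg _
  have hx2 : x ^ 2 = q₀ := by rw [hx]; exact Real.sq_sqrt hq0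
  -- `ζ = s·x_*` on the domain
  have hζ : ∀ b ∈ r.domain, ζ b = (s : ℝ) * x := fun b hb => by
    have h2 := hsq b hb
    have hsg := (hH b hb).2
    rcases hs with rfl | rfl
    · have hz : 0 ≤ ζ b := by simpa using hsg
      rw [Rat.cast_one, one_mul, hx, ← h2, Real.sqrt_sq hz]
    · have hz : 0 ≤ -ζ b := by
        rw [Rat.cast_neg, Rat.cast_one, neg_one_mul] at hsg
        exact hsg
      rw [Rat.cast_neg, Rat.cast_one, hx, ← h2, show ζ b ^ 2 = (-ζ b) ^ 2 by ring, Real.sqrt_sq hz]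
      ring
  by_cases hg : g = 0
  · -- `x_* = 0`: the integrand vanishes
    have hq : q₀ = 0 := by
      have h : (e : ℝ) * q₀ = 0 := by rw [heq, hg]; simp
      rcases mul_eq_zero.1 h with h1 | h1
      · exact absurd h1 he'.ne'
      · exact h1
    have hx0 : x = 0 := by rw [hx, hq, Real.sqrt_zero]
    refine InBaker.of_eqOn_ratCast r 0 fun b hb => ?_
    rw [hr hb]
    dsimp only
    rw [hpot_eq, snoc₂_one, hζ b hb, hx0]
    simp
  · have hq₀' : 0 < -g / e := by
      have hne : q₀ ≠ 0 := by
        intro h0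
        rw [h0, mul_zero] at heq
        exact hg (by exact_mod_cast (neg_eq_zero.1 heq.symm))
      have h : (0 : ℝ) < ((-g / e : ℚ) : ℝ) := hq₀ ▸ lt_of_le_of_ne hq0 (Ne.symm hne)
      exact_mod_cast h
    refine InBaker.sqrt_const_even (-g / e) hq₀'
      (Polynomial.C (s * (4 * γ * g / 3)) * (1 - Polynomial.C m * Polynomial.X) ^ 2)
      ((1 + Polynomial.C m * Polynomial.X) ^ 3) r (fun b _ => ?_) fun b hb => ?_
    · have h : (0 : ℝ) < (1 + (m : ℝ) * b 0 ^ 2) ^ 3 := pow_pos (one_add_pos hm (b 0)) 3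
      simpa using h.ne'
    · have hqD : qD 0 0 (-g / e) (b 0) = q₀ := by rw [hq₀]; simp [qD]
      rw [hr hb]
      dsimp only
      rw [hpot_eq, snoc₂_zero, snoc₂_one, hζ b hb, hqD, ← hx]
      simp only [map_mul, map_pow, map_sub, map_add, map_one, Polynomial.aeval_C, Polynomial.aeval_X,
        eq_ratCast, gW]
      have hx3 : ((s : ℝ) * x) ^ 3 = (s : ℝ) * x * q₀ := by
        rw [show ((s : ℝ) * x) ^ 3 = (s : ℝ) ^ 2 * s * (x ^ 2 * x) by ring, hs2, hx2]
        ring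
      rw [hx3]
      have hden : (1 + (m : ℝ) * b 0 ^ 2) ^ 3 ≠ 0 := (pow_pos (one_add_pos hm (b 0)) 3).ne'
      have hg' : (g : ℝ) = -((e : ℝ) * q₀) := by rw [heq, neg_neg]
      push_cast
      rw [hg']
      field_simp
      ring

end Summit.KontsevichZagierPeriods.RootDecompWalshStrata.ConicDescent.BallCube
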